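import Literature.Computability.Complexity.GraphCanonizationProgramMachine
import Literature.Computability.Complexity.GraphCanonizationProofs
import Literature.Computability.Complexity.CodeFPTableKit
import HarnessLib

/-!
# The canoniser as a list program: input and output codes

Bridges between the tree's code of a coloured graph (`colGraphCode`, `GraphCanonization.lean`)
and the list data the program of `GraphCanonizationProgram*.lean` works on:

* `colGraphCode_eq` — `colGraphCode k G col` is the typed code `ginE ((k, (adjOf G).flatten), (k, colOf col))`
  (binary `k`, the row-major adjacency bits, unary `k`, the colour numerals);
* `chunksL_flatten_adjOf` — cutting the adjacency bits into `k` blocks of `k` gives the rows `adjOf G`;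
* `RowsOK`, `exists_adjOf_eq`, `exists_colOf_eq` — well-formed rows / colour lists come from a
  coloured graph (the program runs the machine only on well-formed data, so that the size
  invariant of the genuine run applies);
* `adjOf_cf`, `colOf_cf` — the canonical form `cf` read back as lists is the canonical code;
* `five_mul_two_pow_le_length_padCore` — with pad exponent `18` the pad is long enough for the
  whole run (`5 · 2^{14k+1}` transitions), and `runL_ret` — a finished configuration is a fixed point.

## References

* S. Arora, B. Barak, *Computational Complexity: A Modern Approach*, CUP 2009, §0.1, §1.3. [AroraBarakCC2009]
* L. Babai, E. M. Luks, *Canonical labeling of graphs*, STOC 1983, §4. [BabaiLuks1983]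
-/

namespace Literature.Computability.Complexity

open _root_.Computability Literature.Combinatorics.SimpleGraph Finset ColourRefinementScheme CodeFP CGCanon

open scoped Classical

noncomputable section

namespace CGProg

variable {k : ℕ}

/-! ### The code of a coloured graph as a typed code -/

/-- The data of a coloured-graph code: `((k, adjacency bits), (k, colours))`. [folklore] -/
abbrev GIn : Type := (ℕ × List Bool) × (ℕ × List ℕ)

/-- Its code: binary, string, unary, raw numerals. [folklore] -/
abbrev ginE : GIn → List Bool := pairE (pairE natE strE) (pairE unE (rawE natE))

/-- Row-major indices. [folklore] -/
theorem finProdFinEquiv_symm_mk (i j : Fin k) (h : i.val * k + j.val < k * k) :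
    finProdFinEquiv.symm (⟨i.val * k + j.val, h⟩ : Fin (k * k)) = (i, j) := by
  rw [Equiv.symm_apply_eq]
  exact Fin.ext (by simp only [finProdFinEquiv_apply_val]; ring)

/-- **The adjacency bits are the rows, flattened.** [cite: AroraBarakCC2009, §0.1] -/
theorem encode_eq_flatten_adjOf (G : SimpleGraph (Fin k)) : (encodingGraphFin k).encode G = (adjOf G).flatten := by
  change List.ofFn _ = _
  rw [List.ofFn_mul]
  unfold adjOf
  congr 1
  refine List.ofFn_inj.2 (funext fun i => List.ofFn_inj.2 (funext fun j => ?_))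
  rw [finProdFinEquiv_symm_mk]

/-- **The code of a coloured graph, typed.** [cite: AroraBarakCC2009, §0.1] -/
theorem colGraphCode_eq (k : ℕ) (G : SimpleGraph (Fin k)) (col : Fin k → ℕ) :
    colGraphCode k G col = ginE ((k, (adjOf G).flatten), (k, colOf col)) := by
  unfold colGraphCode
  rw [encodingGraph_encode, encode_eq_flatten_adjOf]
  change boolPair (boolPair (natE k) _) (encodingNatBool.listBool.encode (List.ofFn col)) = _
  rw [congrFun (listE_eq encodingNatBool) (List.ofFn col), natE_eq]
  simp [listE, colOf]

/-- The typed code is at least as long as `k` (the unary header). [folklore] -/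
theorem le_length_ginE (p : GIn) : p.2.1 ≤ (ginE p).length := by
  obtain ⟨⟨a, b⟩, c, d⟩ := p
  simp only [length_pairE_mk, length_unE]
  omega

/-! ### Rows from the adjacency bits -/

/-- Cutting a bit string into `n` consecutive blocks of length `n`. [folklore] -/
def chunksL (n : ℕ) (bits : List Bool) : List (List Bool) := (List.range n).map fun i => (bits.drop (i * n)).take n

/-- Block `i` of the flattening of rows of length `n` is row `i`. [folklore] -/
theorem take_drop_flatten {n : ℕ} : ∀ (L : List (List Bool)), (∀ r ∈ L, r.length = n) → ∀ (i : ℕ) (hi : i < L.length),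
    (L.flatten.drop (i * n)).take n = L[i]
  | [], _, i, hi => absurd hi (Nat.not_lt_zero _)
  | r :: L, hr, 0, _ => by
    rw [List.flatten_cons, Nat.zero_mul, List.drop_zero, List.take_left' (hr r List.mem_cons_self)]; rfl
  | r :: L, hr, i + 1, hi => by
    have hrn : r.length = n := hr r List.mem_cons_self
    rw [List.flatten_cons, show (i + 1) * n = n + i * n by ring, ← List.drop_drop, List.drop_left' hrn]
    exact take_drop_flatten L (fun r' hr' => hr r' (List.mem_cons_of_mem _ hr')) i (by simpa using hi)

/-- **Cutting the flattened rows gives the rows back.** [folklore] -/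
theorem chunksL_flatten {n : ℕ} {L : List (List Bool)} (hL : L.length = n) (hr : ∀ r ∈ L, r.length = n) : chunksL n L.flatten = L := by
  refine List.ext_getElem (by simp [chunksL, hL]) fun i h₁ h₂ => ?_
  simp only [chunksL, List.getElem_map, List.getElem_range]
  exact take_drop_flatten L hr i h₂

/-- Rows of a graph have length `k`. [folklore] -/
theorem length_of_mem_adjOf (G : SimpleGraph (Fin k)) {r : List Bool} (hr : r ∈ adjOf G) : r.length = k := by
  unfold adjOf at hr
  obtain ⟨i, rfl⟩ := List.mem_ofFn.1 hr
  exact List.length_ofFn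

/-- Hence for the rows of a graph. [folklore] -/
theorem chunksL_flatten_adjOf (G : SimpleGraph (Fin k)) : chunksL k (adjOf G).flatten = adjOf G :=
  chunksL_flatten (length_adjOf G) fun _ hr => length_of_mem_adjOf G hr

/-! ### Well-formed rows and colour lists -/

/-- Well-formed rows: an `n × n` bit matrix, symmetric with zero diagonal. [folklore] -/
def RowsOK (n : ℕ) (rows : List (List Bool)) : Prop :=
  rows.length = n ∧ (∀ r ∈ rows, r.length = n) ∧ (∀ i j, i < n → j < n → adjAt rows i j = adjAt rows j i) ∧ ∀ i, i < n → adjAt rows i i = false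

/-- An `n × n` matrix is the table of its entries. [folklore] -/
theorem eq_ofFn_adjAt {n : ℕ} {rows : List (List Bool)} (h1 : rows.length = n) (h2 : ∀ r ∈ rows, r.length = n) :
    rows = List.ofFn fun i : Fin n => List.ofFn fun j : Fin n => adjAt rows i j := by
  refine List.ext_getElem (by rw [List.length_ofFn, h1]) fun i hi₁ hi₂ => ?_
  simp only [List.getElem_ofFn]
  have hri : (rows[i]).length = n := h2 _ (List.getElem_mem hi₁)
  refine List.ext_getElem (by rw [List.length_ofFn, hri]) fun j hj₁ hj₂ => ?_
  simp only [List.getElem_ofFn, adjAt, bitAt]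
  rw [List.getD_eq_getElem _ _ hi₁, List.getD_eq_getElem _ _ hj₁]

/-- **Well-formed rows are the rows of a graph.** [folklore] -/
theorem exists_adjOf_eq {n : ℕ} {rows : List (List Bool)} (h : RowsOK n rows) : ∃ G : SimpleGraph (Fin n), adjOf G = rows := by
  obtain ⟨h1, h2, hsymm, hirr⟩ := h
  refine ⟨SimpleGraph.fromRel fun i j : Fin n => adjAt rows i j = true, ?_⟩
  conv_rhs => rw [eq_ofFn_adjAt h1 h2]
  unfold adjOf
  refine List.ofFn_inj.2 (funext fun i => List.ofFn_inj.2 (funext fun j => ?_))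
  rw [Bool.eq_iff_iff]
  refine (@decide_eq_true_iff _ (_)).trans ?_
  rw [SimpleGraph.fromRel_adj]
  constructor
  · rintro ⟨hne, h | h⟩
    · exact h
    · rwa [hsymm i j i.isLt j.isLt]
  · intro h
    refine ⟨fun hij => ?_, Or.inl h⟩
    subst hij
    rw [hirr i i.isLt] at h
    exact Bool.false_ne_true h

/-- The rows of a graph are well formed. [folklore] -/
theorem rowsOK_adjOf (G : SimpleGraph (Fin k)) : RowsOK k (adjOf G) := by
  refine ⟨length_adjOf G, fun r hr => length_of_mem_adjOf G hr, fun i j hi hj => ?_, fun i hi => ?_⟩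
  · rw [show i = (⟨i, hi⟩ : Fin k).val from rfl, show j = (⟨j, hj⟩ : Fin k).val from rfl, adjAt_adjOf, adjAt_adjOf, G.adj_comm]
  · rw [show i = (⟨i, hi⟩ : Fin k).val from rfl, adjAt_adjOf]
    simp

/-- **A colour list of length `n` is the colour list of a colouring.** [folklore] -/
theorem exists_colOf_eq {n : ℕ} {cols : List ℕ} (h : cols.length = n) : ∃ c : Fin n → ℕ, colOf c = cols :=
  ⟨fun i => natAt cols i, List.ext_getElem (by rw [length_colOf, h]) fun i hi₁ hi₂ => by
    unfold colOf natAt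
    rw [List.getElem_ofFn, List.getD_eq_getElem _ _ hi₂]⟩

/-- The mask of the whole vertex set. [folklore] -/
theorem maskOf_univ : maskOf (univ : Finset (Fin k)) = List.replicate k true := by
  unfold maskOf
  rw [← List.ofFn_const]
  simp

/-! ### The canonical form read back -/

/-- **The rows of the canonical form are the rows of the canonical code.** [cite: BabaiLuks1983, §4] -/
theorem adjOf_cf (R : Refiner k) (G : SimpleGraph (Fin k)) (col : Fin k → ℕ) : adjOf (cf R G col).1 = (ofLex (canonCode R G col)).1 := by
  have hlen : (ofLex (canonCode R G col)).1.length = k := by simp [canonCode, code, length_canonOrd]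
  symm
  refine List.ext_getElem (by rw [length_adjOf, hlen]) fun i hi₁ hi₂ => ?_
  have hi : i < k := hlen ▸ hi₁
  have hrow : ((ofLex (canonCode R G col)).1[i]).length = k := by
    simp [canonCode, code, List.getElem_map, length_canonOrd]
  refine List.ext_getElem (by unfold adjOf; rw [List.getElem_ofFn, List.length_ofFn, hrow]) fun j hj₁ hj₂ => ?_
  have hj : j < k := hrow ▸ hj₁
  have h := canonCode_adj_getD (R := R) (G := G) (col := col) hi hj
  rw [List.getD_eq_getElem _ _ hi₁, List.getD_eq_getElem _ _ hj₁] at h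
  rw [h]
  simp only [adjOf, List.getElem_ofFn]
  rw [Bool.eq_iff_iff]
  refine (@decide_eq_true_iff _ (_)).trans (Iff.trans ?_ (@decide_eq_true_iff _ (_)).symm)
  simp only [cf, SimpleGraph.fromRel_adj, ne_eq, Fin.mk.injEq]
  rw [canonCode_adj_getD hi hj, canonCode_adj_getD hj hi]
  refine Iff.trans ?_ (and_congr_right' (or_congr (@decide_eq_true_iff _ (_)) (@decide_eq_true_iff _ (_))).symm)
  rw [G.adj_comm ((canonOrd R G col)[j]'_)]
  constructor
  · intro h'
    refine ⟨fun hij => ?_, Or.inl h'⟩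
    subst hij
    exact h'.ne rfl
  · rintro ⟨-, h' | h'⟩ <;> exact h'

/-- **The colours of the canonical form are the colours of the canonical code.** [cite: BabaiLuks1983, §4] -/
theorem colOf_cf (R : Refiner k) (G : SimpleGraph (Fin k)) (col : Fin k → ℕ) : colOf (cf R G col).2 = (ofLex (canonCode R G col)).2 := by
  have hlen : (ofLex (canonCode R G col)).2.length = k := by simp [canonCode, code, length_canonOrd]
  refine List.ext_getElem (by rw [length_colOf, hlen]) fun i hi₁ hi₂ => ?_
  unfold colOf
  rw [List.getElem_ofFn]
  change (ofLex (canonCode R G col)).2.getD i 0 = _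
  rw [List.getD_eq_getElem _ _ hi₂]

/-- Hence the code of the canonical form is read off the canonical code. [cite: BabaiLuks1983, §4] -/
theorem colGraphCode_cf (R : Refiner k) (G : SimpleGraph (Fin k)) (col : Fin k → ℕ) :
    colGraphCode k (cf R G col).1 (cf R G col).2 = ginE ((k, (ofLex (canonCode R G col)).1.flatten), (k, (ofLex (canonCode R G col)).2)) := by
  rw [colGraphCode_eq, adjOf_cf, colOf_cf]

/-- The canonical code from the lists. [folklore] -/
theorem codeL_canonOrd (G : SimpleGraph (Fin k)) (col : Fin k → ℕ) :
    codeL (adjOf G) (colOf col) ((canonOrd (crRefiner k) G col).map Fin.val) = ofLex (canonCode (crRefiner k) G col) := by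
  rw [codeL_eq]; rfl

/-! ### Fuel -/

/-- **The pad is long enough**: `5 · 2^{14k+1} ≤ |padCore 18 (colGraphCode k G col)|`. [cite: AroraBarakCC2009, §2.6 (padding)] -/
theorem five_mul_two_pow_le_length_padCore (k : ℕ) (G : SimpleGraph (Fin k)) (col : Fin k → ℕ) :
    5 * 2 ^ (14 * k + 1) ≤ (padCore 18 (colGraphCode k G col)).length := by
  rw [length_padCore]
  have hk := le_sqrt_length_colGraphCode k G col
  have h1 : 1 ≤ Nat.sqrt (colGraphCode k G col).length := by
    rw [Nat.le_sqrt, Nat.one_mul]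
    unfold colGraphCode; rw [length_boolPair]; omega
  calc 5 * 2 ^ (14 * k + 1) ≤ 2 ^ 3 * 2 ^ (14 * k + 1) := Nat.mul_le_mul_right _ (by norm_num)
    _ = 2 ^ (14 * k + 4) := by rw [← Nat.pow_add]; ring_nf
    _ ≤ 2 ^ (18 * Nat.sqrt (colGraphCode k G col).length) := Nat.pow_le_pow_right Nat.two_pos (by omega)
    _ ≤ _ := by omega

/-- A finished configuration is a fixed point of the list machine. [folklore] -/
theorem runL_ret (n : ℕ) (A : List (List Bool)) (m : ℕ) (o : List ℕ) : runL n A m [LFrame.ret o] = [LFrame.ret o] := by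
  induction m with
  | zero => rfl
  | succ m ih => unfold runL at ih ⊢; rw [Function.iterate_succ_apply]; exact ih

/-- **Any long enough run from the root ends in the canonical ordering.** [cite: Laubner2011, §3.4] -/
theorem runL_root_of_le (G : SimpleGraph (Fin k)) (col : Fin k → ℕ) {m : ℕ} (hm : 5 * 2 ^ (14 * k + 1) ≤ m) :
    runL k (adjOf G) m [classifyL k (adjOf G) (maskOf (univ : Finset (Fin k))) (refineL k (adjOf G) (maskOf (univ : Finset (Fin k))) (colOf col))] =
      [LFrame.ret ((canonOrd (crRefiner k) G col).map Fin.val)] := by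
  obtain ⟨d, rfl⟩ := Nat.exists_eq_add_of_le hm
  unfold runL
  rw [Nat.add_comm, Function.iterate_add_apply]
  change runL k (adjOf G) d (runL k (adjOf G) (5 * 2 ^ (14 * k + 1)) _) = _
  rw [runL_root, runL_ret]

end CGProg

end

end Literature.Computability.Complexity
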